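import Literature.Geometry.Lorentzian.KerrCarterRadialODEStar
import Literature.Geometry.Lorentzian.KerrCarterNormalForm
import Literature.Geometry.Lorentzian.KerrTortoiseRadiusSurj
import Literature.Analysis.Calculus.ZeroExtensionDeriv
import HarnessLib

/-!
# The Carter-mode interface: global `C²` solutions of `u'' + (ω² - V)u = H` with compact
# `r*`-support, for a.e. frequency and every spheroidal mode

Dafermos–Rodnianski–Shlapentokh-Rothman, arXiv:1402.7034, §5 (Carter's separation) feeding §8
(Theorem 8.1) as used in §13.1.2: for a solution cut off to a compact radial shell,
"the compact `r` support … is inherited by `ũ`", so that the frequency-localised ODE estimates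
apply with trivial boundary terms. Starting from the tree's separation
(`Kerr.carter_radial_ode_star`: `C²`-in-`r` representatives and the star-chart radial ODE on a
radial interval `(r_a, r_b)`, for a.e. `ξ` and every mode `q`) and the normal form
(`Kerr.nfU_ode`), this file produces, for data `Φ, W` **vanishing off a closed shell
`[r_a', r_b'] ⊂ (r_a, r_b)`**, and for a.e. `ξ` and every `q`, functions `U, U₁, U₂, H : ℝ → ℂ`
of the tortoise coordinate with

* `U' = U₁`, `U₁' = U₂`, `U₂ + (ω² - V(ω, m, Λ)(R x)) U = H` **for all `x ∈ ℝ`**, with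
  `ω = -2πξ`, `m = q.1`, `Λ = λ_q(aω) + a²ω²` (`Kerr.sepPotential`), `Λ` admissible
  (`Kerr.isAdmissibleTriple_oblateSphere`);
* `U, U₁, H` continuous and vanishing off a compact `r*`-interval — hence the outgoing boundary
  conditions, the limits `‖U‖² → 0` and the integrability hypotheses of the tree's §8 theorems
  (`trapping_estimate_of_isFreqNatural'`, `timeDominated_estimate_kerr`, …) hold trivially;
* the identification `U(x) = √(r² + a²) e^{-iϑ(r)} ⟪Ψ_q(aω), û(r, ξ)⟫`, `r = R x`, with the
  separation representative `û` (so that Parseval/Plancherel, `KerrStarPlancherel.lean`, turn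
  sums over `q` and integrals over `ξ` of `|U|²`-type quantities into physical-space integrals).

Main statements: `Kerr.carter_radial_ode_star_support` (vanishing of the representatives on the
collars, a.e. in `ξ`), `Kerr.carter_mode_interface`.

## References

* M. Dafermos, I. Rodnianski, Y. Shlapentokh-Rothman, arXiv:1402.7034, §5.2.3, §5.4, §13.1.2.
  [DafermosRodnianskiShlapentokhrothman2014]
-/

noncomputable section

open Real Set Filter MeasureTheory Function
open scoped Topology ENNReal InnerProductSpace ComplexConjugate FourierTransform

namespace Literature.Geometry.Lorentzian

namespace Kerr

open Literature.Analysis.SpecialFunctions Literature.Analysis.FunctionSpaces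
  Literature.Analysis.Fourier Literature.Analysis.Calculus

variable [h2π : Fact (0 < 2 * π)]

/-! ### Admissibility of `Λ = λ_q(aω) + a²ω²` -/

omit h2π in
/-- **`(ω, m, λ_q(aω) + a²ω²)` is an admissible triple** (DRSR (33), (34) ⇒ Def. 6.1.1).
[cite: DafermosRodnianskiShlapentokhrothman2014, §5.2.1 (33)–(34), Def. 6.1.1] -/
theorem isAdmissibleTriple_oblateSphere (a ω : ℝ) (q : OblateSphereIndex (a * ω)) :
    IsAdmissibleTriple a ω q.1 (oblateSphereEig (a * ω) q + a ^ 2 * ω ^ 2) := by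
  have h1 := le_oblateSphereEig (a * ω) q
  have h2 := two_mul_abs_le_oblateSphereEig (a * ω) q
  refine ⟨by nlinarith [h1], ?_⟩
  rw [show a * (q.1 : ℝ) * ω = (q.1 : ℝ) * (a * ω) by ring, abs_mul]
  nlinarith [h2, abs_nonneg (a * ω), sq_abs (a * ω)]

/-! ### Vanishing of the frequency classes off the shell -/

/-- If `G` vanishes on the coordinate slab `{q 1 = r}`, its angular slice at `(t, r)` is `0`.
[folklore] -/
theorem angSlice_eq_zero {G : E4 → ℝ} (hG : Continuous G) {r : ℝ} (hz : ∀ q : E4, q 1 = r → G q = 0)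
    (t : ℝ) : angSlice G hG t r = 0 := by
  rw [angSlice_def, polarLp]
  refine Lp.eq_zero_iff_ae_eq_zero.2 ?_
  filter_upwards [MemLp.coeFn_toLp (memLp_polarFn (2 * π) (continuous_coordSlice hG t r))]
    with z hz'
  rw [hz', polarFn_coordSlice, hz _ (starq_apply_one _ _ _ _), Complex.ofReal_zero]; rfl

/-- If `G` vanishes on `{q 1 = r}`, its frequency class at `r` is `0`. [folklore] -/
theorem freqLp_eq_zero {G : E4 → ℝ} (hG : Continuous G) (hI : ∀ r, TimeSqInt G hG r) {r : ℝ}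
    (hz : ∀ q : E4, q 1 = r → G q = 0) : freqLp G hG hI r = 0 := by
  have ht : timeLp G hG hI r = 0 := by
    refine Lp.eq_zero_iff_ae_eq_zero.2 ?_
    filter_upwards [coeFn_timeLp G hG hI r] with t ht
    rw [ht, angSlice_eq_zero hG hz t]; rfl
  rw [freqLp_eq_clm]
  simp only [ht, map_zero]

/-! ### The separation representatives vanish on the collars -/

/-- **`Kerr.carter_radial_ode_star` for data vanishing off a shell `[r_a', r_b'] ⊂ (r_a, r_b)`**:
the `C²`-in-`r` representatives `u` (of `𝓕_t F`) and `w` (of `𝓕_t W`) moreover vanish, for a.e.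
`ξ`, at **every** radius of the open collars `(r_a, r_a') ∪ (r_b', r_b)`.
[cite: DafermosRodnianskiShlapentokhrothman2014, §13.1.2 (compact `r`-support is inherited)] -/
theorem carter_radial_ode_star_support (a M : ℝ) {Φ : E4 → ℝ} (hΦ : ContDiff ℝ 4 Φ) {W : E4 → ℝ}
    (hW2 : ContDiff ℝ 2 W) (hW : ∀ q : E4, 0 < q 1 → sin (q 2) ≠ 0 → W q = sepRHS a M Φ q)
    (hIW : ∀ r, TimeSqInt W hW2.continuous r)
    (hIW1 : ∀ r, TimeSqInt (dir 1 W) (contDiff_one_dir hW2 1).continuous r)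
    {cW : ℝ} (hcW : 0 ≤ cW)
    (hBW : ∀ r, ∫⁻ t, ‖angSlice (dir 1 (dir 1 W))
      (continuous_dir (contDiff_one_dir hW2 1) one_ne_zero 1) t r‖ₑ ^ 2 ≤ ENNReal.ofReal (cW ^ 2))
    (hIF : ∀ r, TimeSqInt (starPull a Φ)
      (contDiff_two_starPull a (contDiff_two_of_four hΦ)).continuous r)
    (hI0 : ∀ r, TimeSqInt (dir 0 (starPull a Φ))
      (continuous_dir (contDiff_one_starPull a (contDiff_two_of_four hΦ)) one_ne_zero 0) r)
    (hJ1 : ∀ r, TimeSqInt (dir 1 (starPull a Φ)) (contDiff_two_D1 a hΦ).continuous r)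
    (hJ2 : ∀ r, TimeSqInt (dir 1 (dir 1 (starPull a Φ))) (contDiff_two_D2 a hΦ).continuous r)
    (hJ3 : ∀ r, TimeSqInt (dir 1 (dir 1 (dir 1 (starPull a Φ))))
      (contDiff_one_D3 a hΦ).continuous r)
    (hIA : ∀ i r, TimeSqInt (sepAtom a Φ i) (continuous_sepAtom a (contDiff_two_of_four hΦ) i) r)
    {c : ℝ} (hc : 0 ≤ c)
    (hB2 : ∀ r, ∫⁻ t, ‖angSlice (dir 1 (dir 1 (starPull a Φ))) (contDiff_two_D2 a hΦ).continuous
      t r‖ₑ ^ 2 ≤ ENNReal.ofReal (c ^ 2))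
    (hB3 : ∀ r, ∫⁻ t, ‖angSlice (dir 1 (dir 1 (dir 1 (starPull a Φ))))
      (contDiff_one_D3 a hΦ).continuous t r‖ₑ ^ 2 ≤ ENNReal.ofReal (c ^ 2))
    (hB4 : ∀ r, ∫⁻ t, ‖angSlice (dir 1 (dir 1 (dir 1 (dir 1 (starPull a Φ)))))
      (continuous_D4 a hΦ) t r‖ₑ ^ 2 ≤ ENNReal.ofReal (c ^ 2))
    {r_a r_b : ℝ} (hra : 0 < r_a) (hab : r_a ≤ r_b)
    {r_a' r_b' : ℝ} (hra' : r_a < r_a') (hab' : r_a' ≤ r_b') (hrb' : r_b' < r_b)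
    (hzF : ∀ q : E4, q 1 ∈ Ioo r_a r_b → q 1 ∉ Icc r_a' r_b' → starPull a Φ q = 0)
    (hzW : ∀ q : E4, q 1 ∈ Ioo r_a r_b → q 1 ∉ Icc r_a' r_b' → W q = 0) :
    ∃ u u₁ u₂ w : ℝ → ℝ → AngSpace,
      (∀ r ∈ Icc r_a r_b, u r =ᵐ[volume]
        (freqLp (starPull a Φ) (contDiff_two_starPull a (contDiff_two_of_four hΦ)).continuous
          hIF r : ℝ → AngSpace)) ∧
      (∀ r ∈ Icc r_a r_b, w r =ᵐ[volume] (freqLp W hW2.continuous hIW r : ℝ → AngSpace)) ∧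
      ∀ᵐ ξ ∂volume,
        ContinuousOn (fun r ↦ w r ξ) (Icc r_a r_b) ∧ ContinuousOn (fun r ↦ u₂ r ξ) (Icc r_a r_b) ∧
        (∀ r ∈ Ioo r_a r_b, HasDerivAt (fun r ↦ u₁ r ξ) (u₂ r ξ) r) ∧
        (∀ r ∈ Ioo r_a r_b, HasDerivAt (fun r ↦ u r ξ) (u₁ r ξ) r) ∧
        (∀ r ∈ Ioo r_a r_b, r ∉ Icc r_a' r_b' → u r ξ = 0 ∧ w r ξ = 0) ∧
        ∀ q : OblateSphereIndex (a * (-2 * π * ξ)), ∀ r ∈ Ioo r_a r_b,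
          ((r ^ 2 - 2 * M * r + a ^ 2 : ℝ) : ℂ) *
              ⟪oblateSphereBasis (2 * π) (a * (-2 * π * ξ)) q, u₂ r ξ⟫_ℂ +
            ((2 * (r - M) : ℝ) + 2 * Complex.I * (a * q.1 - 2 * M * r * (-2 * π * ξ))) *
              ⟪oblateSphereBasis (2 * π) (a * (-2 * π * ξ)) q, u₁ r ξ⟫_ℂ +
            (((-2 * π * ξ) ^ 2 * (r ^ 2 + 2 * M * r) : ℝ) - 2 * Complex.I * M * (-2 * π * ξ) -
                (oblateSphereEig (a * (-2 * π * ξ)) q : ℂ)) *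
              ⟪oblateSphereBasis (2 * π) (a * (-2 * π * ξ)) q, u r ξ⟫_ℂ =
          ⟪oblateSphereBasis (2 * π) (a * (-2 * π * ξ)) q, w r ξ⟫_ℂ := by
  obtain ⟨u, u₁, u₂, w, hru, hrw, hae⟩ := carter_radial_ode_star a M hΦ hW2 hW hIW hIW1 hcW hBW
    hIF hI0 hJ1 hJ2 hJ3 hIA hc hB2 hB3 hB4 hra hab
  refine ⟨u, u₁, u₂, w, hru, hrw, ?_⟩
  -- the frequency classes vanish on the collars
  have hzero : ∀ r ∈ Ioo r_a r_b, r ∉ Icc r_a' r_b' →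
      freqLp (starPull a Φ) (contDiff_two_starPull a (contDiff_two_of_four hΦ)).continuous hIF r
        = 0 ∧ freqLp W hW2.continuous hIW r = 0 := fun r hr hr' ↦
    ⟨freqLp_eq_zero _ hIF fun q hq ↦ hzF q (hq ▸ hr) (hq ▸ hr'),
      freqLp_eq_zero _ hIW fun q hq ↦ hzW q (hq ▸ hr) (hq ▸ hr')⟩
  -- hence the representatives vanish at every rational collar radius, a.e.
  have hrat : ∀ᵐ ξ ∂volume, ∀ s : ℚ, (s : ℝ) ∈ Ioo r_a r_b → (s : ℝ) ∉ Icc r_a' r_b' →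
      u s ξ = 0 ∧ w s ξ = 0 := by
    refine ae_all_iff.2 fun s ↦ ?_
    by_cases hs : (s : ℝ) ∈ Ioo r_a r_b ∧ (s : ℝ) ∉ Icc r_a' r_b'
    · have hs' : (s : ℝ) ∈ Icc r_a r_b := Ioo_subset_Icc_self hs.1
      have hz := hzero _ hs.1 hs.2
      filter_upwards [hru _ hs', hrw _ hs',
        Lp.coeFn_zero AngSpace 2 (volume : Measure ℝ)] with ξ h1 h2 h0
      intro _ _
      rw [h1, h2, hz.1, hz.2]
      exact ⟨h0, h0⟩
    · exact ae_of_all _ fun ξ h1 h2 ↦ absurd ⟨h1, h2⟩ hs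
  filter_upwards [hae, hrat] with ξ hξ hQ
  obtain ⟨hwc, hc2, hd1, hd0, hode⟩ := hξ
  refine ⟨hwc, hc2, hd1, hd0, fun r hr hr' ↦ ?_, hode⟩
  have hcu : ContinuousOn (fun r ↦ u r ξ) (Ioo r_a r_b) :=
    fun r hr ↦ (hd0 r hr).continuousAt.continuousWithinAt
  -- the two collars
  rcases not_and_or.1 hr' with hlt | hgt
  · -- left collar `(r_a, r_a')`
    have hrl : r < r_a' := lt_of_not_ge hlt
    have hsub : Ioo r_a r_a' ⊆ Ioo r_a r_b := fun s hs ↦ ⟨hs.1, hs.2.trans_le (hab'.trans hrb'.le)⟩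
    have hmem : r ∈ Ioo r_a r_a' := ⟨hr.1, hrl⟩
    constructor
    · refine eqOn_Ioo_of_rat (f := fun r ↦ u r ξ) (g := fun _ ↦ (0 : AngSpace)) (hcu.mono hsub)
        continuousOn_const (fun s hs ↦ (hQ s (hsub hs) fun h ↦ ?_).1) r hmem
      exact absurd hs.2 (not_lt.2 h.1)
    · refine eqOn_Ioo_of_rat (f := fun r ↦ w r ξ) (g := fun _ ↦ (0 : AngSpace))
        (hwc.mono (hsub.trans Ioo_subset_Icc_self)) continuousOn_const
        (fun s hs ↦ (hQ s (hsub hs) fun h ↦ ?_).2) r hmem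
      exact absurd hs.2 (not_lt.2 h.1)
  · -- right collar `(r_b', r_b)`
    have hrl : r_b' < r := lt_of_not_ge hgt
    have hsub : Ioo r_b' r_b ⊆ Ioo r_a r_b := fun s hs ↦ ⟨(hra'.trans_le hab').trans hs.1, hs.2⟩
    have hmem : r ∈ Ioo r_b' r_b := ⟨hrl, hr.2⟩
    constructor
    · refine eqOn_Ioo_of_rat (f := fun r ↦ u r ξ) (g := fun _ ↦ (0 : AngSpace)) (hcu.mono hsub)
        continuousOn_const (fun s hs ↦ (hQ s (hsub hs) fun h ↦ ?_).1) r hmem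
      exact absurd hs.1 (not_lt.2 h.2)
    · refine eqOn_Ioo_of_rat (f := fun r ↦ w r ξ) (g := fun _ ↦ (0 : AngSpace))
        (hwc.mono (hsub.trans Ioo_subset_Icc_self)) continuousOn_const
        (fun s hs ↦ (hQ s (hsub hs) fun h ↦ ?_).2) r hmem
      exact absurd hs.1 (not_lt.2 h.2)

/-! ### Boundary conditions and integrability from compact `r*`-support -/

omit h2π in
/-- **The remaining hypotheses of the §8 theorems are automatic** for continuous `U, U₁, H`
vanishing off a compact `r*`-interval: the outgoing conditions `U₁ ∓ i(…)U → 0` at `±∞`, the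
limits `‖U‖² → 0`, and the integrability of `Re(H Ū₁)`, `Im(H Ū)`. [folklore] -/
theorem mode_bc_of_support {U U₁ H : ℝ → ℂ} {x_a x_b : ℝ} (hUc : Continuous U)
    (hU₁c : Continuous U₁) (hHc : Continuous H) (hs : ∀ x, x ∉ Icc x_a x_b → U x = 0 ∧ U₁ x = 0 ∧ H x = 0) (α β : ℂ) :
    Tendsto (fun x ↦ U₁ x - α * U x) atTop (𝓝 0) ∧
      Tendsto (fun x ↦ U₁ x + β * U x) atBot (𝓝 0) ∧
      Tendsto (fun x ↦ ‖U x‖ ^ 2) atTop (𝓝 0) ∧ Tendsto (fun x ↦ ‖U x‖ ^ 2) atBot (𝓝 0) ∧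
      Integrable (fun x ↦ ⟪H x, U₁ x⟫_ℝ) ∧ Integrable (fun x ↦ (H x * conj (U x)).im) := by
  have htop : ∀ᶠ x in atTop, x ∉ Icc x_a x_b :=
    (eventually_gt_atTop x_b).mono fun x hx h ↦ not_le.2 hx h.2
  have hbot : ∀ᶠ x in atBot, x ∉ Icc x_a x_b :=
    (eventually_lt_atBot x_a).mono fun x hx h ↦ not_le.2 hx h.1
  have hK : ∀ {f : ℝ → ℂ}, Continuous f → (∀ x, x ∉ Icc x_a x_b → f x = 0) → Integrable f :=
    fun hf hz ↦ hf.integrable_of_hasCompactSupport (HasCompactSupport.intro isCompact_Icc hz)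
  refine ⟨?_, ?_, ?_, ?_, ?_, ?_⟩
  · refine tendsto_const_nhds.congr' (htop.mono fun x hx ↦ ?_)
    simp [(hs x hx).1, (hs x hx).2.1]
  · refine tendsto_const_nhds.congr' (hbot.mono fun x hx ↦ ?_)
    simp [(hs x hx).1, (hs x hx).2.1]
  · refine tendsto_const_nhds.congr' (htop.mono fun x hx ↦ ?_)
    simp [(hs x hx).1]
  · refine tendsto_const_nhds.congr' (hbot.mono fun x hx ↦ ?_)
    simp [(hs x hx).1]
  · have h := hK (hU₁c.mul (Complex.continuous_conj.comp hHc)) fun x hx ↦ by simp [(hs x hx).2.1]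
    refine (h.re).congr (ae_of_all _ fun x ↦ ?_)
    show RCLike.re (U₁ x * conj (H x)) = ⟪H x, U₁ x⟫_ℝ
    rw [Complex.inner]
    rfl
  · have h := hK (hHc.mul (Complex.continuous_conj.comp hUc)) fun x hx ↦ by simp [(hs x hx).2.2]
    exact h.im

/-! ### The mode data -/

/-- **The zero-extended mode coefficient** `r ↦ ⟪Ψ, v(r, ξ)⟫` of a representative `v`, off
`(r_a, r_b)` extended by `0`. [cite: DafermosRodnianskiShlapentokhrothman2014, §5.2.3 (35)] -/
def modeCoef (Ψ : AngSpace) (v : ℝ → ℝ → AngSpace) (ξ r_a r_b : ℝ) : ℝ → ℂ :=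
  zeroExtend r_a r_b fun r ↦ ⟪Ψ, v r ξ⟫_ℂ

/-- **The `r*`-source** `H(x) = Δ e^{-iϑ} G / ((r² + a²)√(r² + a²))`, `r = R x` (DRSR (38)).
[cite: DafermosRodnianskiShlapentokhrothman2014, Prop. 5.2.1 (38)] -/
def modeH (M a : ℝ) (R ϑ : ℝ → ℝ) (G : ℝ → ℂ) (x : ℝ) : ℂ :=
  ((delta M a (R x) / ((R x ^ 2 + a ^ 2) * Real.sqrt (R x ^ 2 + a ^ 2)) : ℝ) : ℂ) *
    Complex.exp (-Complex.I * ϑ (R x)) * G (R x)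

/-- Mode coefficients are differentiable in `r` where the representative is. [folklore] -/
theorem hasDerivAt_inner_rep (Ψ : AngSpace) {v v₁ : ℝ → ℝ → AngSpace} {ξ r : ℝ}
    (h : HasDerivAt (fun r ↦ v r ξ) (v₁ r ξ) r) :
    HasDerivAt (fun r ↦ ⟪Ψ, v r ξ⟫_ℂ) ⟪Ψ, v₁ r ξ⟫_ℂ r := by
  exact ((innerSL ℂ Ψ : AngSpace →L[ℂ] ℂ).restrictScalars ℝ).hasFDerivAt.comp_hasDerivAt r h

/-- **The Carter-mode interface.** Hypotheses: those of `carter_radial_ode_star_support`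
(`Φ ∈ C⁴`, source `W`, time square-integrability with uniform-in-`r` bounds, data vanishing off the
shell `[r_a', r_b'] ⊂ (r_a, r_b)`), sub-extremality, `r₊ < r_a`, and a tortoise radius function `R`.
Conclusion: separation representatives `u` (of `𝓕_t(Φ∘κ_a)`) and `w` (of `𝓕_t W`) such that for
a.e. `ξ` and **every** mode `q` (`ω = -2πξ`, `m = q.1`, `Λ = λ_q(aω) + a²ω²`, `ϑ = nfPhase`,
`c = modeCoef Ψ_q u ξ r_a r_b`, `c₁ = modeCoef Ψ_q u₁ ξ r_a r_b`,
`G = modeCoef Ψ_q w ξ r_a r_b`), the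
functions `U = nfU a R ϑ c`, `U₁ = nfU₁ M a ω m R ϑ c c₁`, `H = modeH M a R ϑ G` and
`U₂ = H - (ω² - V)U` satisfy every hypothesis of the tree's §8 ODE estimates: `U' = U₁`,
`U₁' = U₂`, the ODE `U₂ + (ω² - V(Λ))U = H` on all of `ℝ`, continuity, vanishing off a compact
`r*`-interval, the outgoing boundary conditions (trivially), `‖U‖² → 0` at both ends, the
integrability of `Re(H Ū₁)` and `Im(H Ū)`, and admissibility of `Λ`.
[cite: DafermosRodnianskiShlapentokhrothman2014, Prop. 5.2.1, Lemma 5.4.1, §13.1.2] -/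
theorem carter_mode_interface (a M : ℝ) (hMa : IsSubextremal M a) {R : ℝ → ℝ}
    (hR : IsTortoiseRadius M a R) {Φ : E4 → ℝ} (hΦ : ContDiff ℝ 4 Φ) {W : E4 → ℝ}
    (hW2 : ContDiff ℝ 2 W) (hW : ∀ q : E4, 0 < q 1 → sin (q 2) ≠ 0 → W q = sepRHS a M Φ q)
    (hIW : ∀ r, TimeSqInt W hW2.continuous r)
    (hIW1 : ∀ r, TimeSqInt (dir 1 W) (contDiff_one_dir hW2 1).continuous r)
    {cW : ℝ} (hcW : 0 ≤ cW)
    (hBW : ∀ r, ∫⁻ t, ‖angSlice (dir 1 (dir 1 W))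
      (continuous_dir (contDiff_one_dir hW2 1) one_ne_zero 1) t r‖ₑ ^ 2 ≤ ENNReal.ofReal (cW ^ 2))
    (hIF : ∀ r, TimeSqInt (starPull a Φ)
      (contDiff_two_starPull a (contDiff_two_of_four hΦ)).continuous r)
    (hI0 : ∀ r, TimeSqInt (dir 0 (starPull a Φ))
      (continuous_dir (contDiff_one_starPull a (contDiff_two_of_four hΦ)) one_ne_zero 0) r)
    (hJ1 : ∀ r, TimeSqInt (dir 1 (starPull a Φ)) (contDiff_two_D1 a hΦ).continuous r)
    (hJ2 : ∀ r, TimeSqInt (dir 1 (dir 1 (starPull a Φ))) (contDiff_two_D2 a hΦ).continuous r)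
    (hJ3 : ∀ r, TimeSqInt (dir 1 (dir 1 (dir 1 (starPull a Φ))))
      (contDiff_one_D3 a hΦ).continuous r)
    (hIA : ∀ i r, TimeSqInt (sepAtom a Φ i) (continuous_sepAtom a (contDiff_two_of_four hΦ) i) r)
    {c : ℝ} (hc : 0 ≤ c)
    (hB2 : ∀ r, ∫⁻ t, ‖angSlice (dir 1 (dir 1 (starPull a Φ))) (contDiff_two_D2 a hΦ).continuous
      t r‖ₑ ^ 2 ≤ ENNReal.ofReal (c ^ 2))
    (hB3 : ∀ r, ∫⁻ t, ‖angSlice (dir 1 (dir 1 (dir 1 (starPull a Φ))))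
      (contDiff_one_D3 a hΦ).continuous t r‖ₑ ^ 2 ≤ ENNReal.ofReal (c ^ 2))
    (hB4 : ∀ r, ∫⁻ t, ‖angSlice (dir 1 (dir 1 (dir 1 (dir 1 (starPull a Φ)))))
      (continuous_D4 a hΦ) t r‖ₑ ^ 2 ≤ ENNReal.ofReal (c ^ 2))
    {r_a r_b : ℝ} (hra : rPlus M a < r_a) (hab : r_a ≤ r_b)
    {r_a' r_b' : ℝ} (hra' : r_a < r_a') (hab' : r_a' ≤ r_b') (hrb' : r_b' < r_b)
    (hzF : ∀ q : E4, q 1 ∈ Ioo r_a r_b → q 1 ∉ Icc r_a' r_b' → starPull a Φ q = 0)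
    (hzW : ∀ q : E4, q 1 ∈ Ioo r_a r_b → q 1 ∉ Icc r_a' r_b' → W q = 0) :
    ∃ u u₁ u₂ w : ℝ → ℝ → AngSpace,
      (∀ r ∈ Icc r_a r_b, u r =ᵐ[volume]
        (freqLp (starPull a Φ) (contDiff_two_starPull a (contDiff_two_of_four hΦ)).continuous
          hIF r : ℝ → AngSpace)) ∧
      (∀ r ∈ Icc r_a r_b, w r =ᵐ[volume] (freqLp W hW2.continuous hIW r : ℝ → AngSpace)) ∧
      ∀ᵐ ξ ∂volume,
        ContinuousOn (fun r ↦ w r ξ) (Icc r_a r_b) ∧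
        (∀ r ∈ Ioo r_a r_b, HasDerivAt (fun r ↦ u r ξ) (u₁ r ξ) r) ∧
        (∀ r ∈ Ioo r_a r_b, HasDerivAt (fun r ↦ u₁ r ξ) (u₂ r ξ) r) ∧
        (∀ r ∈ Ioo r_a r_b, r ∉ Icc r_a' r_b' → u r ξ = 0 ∧ w r ξ = 0) ∧
        ∀ q : OblateSphereIndex (a * (-2 * π * ξ)),
          ∃ U U₁ U₂ H : ℝ → ℂ, ∃ x_a x_b : ℝ,
            U = nfU a R (nfPhase M a (-2 * π * ξ) q.1)
              (modeCoef (oblateSphereBasis (2 * π) (a * (-2 * π * ξ)) q) u ξ r_a r_b) ∧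
            U₁ = nfU₁ M a (-2 * π * ξ) q.1 R (nfPhase M a (-2 * π * ξ) q.1)
              (modeCoef (oblateSphereBasis (2 * π) (a * (-2 * π * ξ)) q) u ξ r_a r_b)
              (modeCoef (oblateSphereBasis (2 * π) (a * (-2 * π * ξ)) q) u₁ ξ r_a r_b) ∧
            H = modeH M a R (nfPhase M a (-2 * π * ξ) q.1)
              (modeCoef (oblateSphereBasis (2 * π) (a * (-2 * π * ξ)) q) w ξ r_a r_b) ∧
            (∀ x, HasDerivAt U (U₁ x) x) ∧ (∀ x, HasDerivAt U₁ (U₂ x) x) ∧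
            (∀ x, U₂ x + (((-2 * π * ξ) ^ 2 - sepPotential M a (-2 * π * ξ) q.1
              (oblateSphereEig (a * (-2 * π * ξ)) q + a ^ 2 * (-2 * π * ξ) ^ 2) (R x) : ℝ) : ℂ) *
                U x = H x) ∧
            Continuous U ∧ Continuous U₁ ∧ Continuous H ∧
            (∀ x, x ∉ Icc x_a x_b → U x = 0 ∧ U₁ x = 0 ∧ H x = 0) ∧
            IsAdmissibleTriple a (-2 * π * ξ) q.1
              (oblateSphereEig (a * (-2 * π * ξ)) q + a ^ 2 * (-2 * π * ξ) ^ 2) := by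
  have hra0 : 0 < r_a := (hMa.pos.trans_le (M_le_rPlus M a)).trans hra
  obtain ⟨u, u₁, u₂, w, hru, hrw, hae⟩ := carter_radial_ode_star_support a M hΦ hW2 hW hIW hIW1
    hcW hBW hIF hI0 hJ1 hJ2 hJ3 hIA hc hB2 hB3 hB4 hra0 hab hra' hab' hrb' hzF hzW
  refine ⟨u, u₁, u₂, w, hru, hrw, ?_⟩
  -- `r*`-interval carrying the shell
  obtain ⟨x_a, hxa⟩ := hR.exists_apply_eq hra
  obtain ⟨x_b, hxb⟩ := hR.exists_apply_eq (hra.trans_le hab)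
  filter_upwards [hae] with ξ hξ
  obtain ⟨hwc, hc2, hd1, hd0, hcollar, hode⟩ := hξ
  refine ⟨hwc, hd0, hd1, hcollar, fun q ↦ ?_⟩
  -- notation (`(-2 * π * ξ) = -2πξ` is kept literal: abstracting it would change the type of `q`)
  set Ψ : AngSpace := oblateSphereBasis (2 * π) (a * (-2 * π * ξ)) q with hΨ
  set ϑ : ℝ → ℝ := nfPhase M a (-2 * π * ξ) q.1 with hϑ
  set lam : ℝ := oblateSphereEig (a * (-2 * π * ξ)) q with hlam
  set cf : ℝ → ℂ := modeCoef Ψ u ξ r_a r_b with hcf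
  set cf₁ : ℝ → ℂ := modeCoef Ψ u₁ ξ r_a r_b with hcf₁
  set cf₂ : ℝ → ℂ := modeCoef Ψ u₂ ξ r_a r_b with hcf₂
  set G : ℝ → ℂ := modeCoef Ψ w ξ r_a r_b with hG
  -- derivatives of the raw coefficients on `(r_a, r_b)` and vanishing on the collars
  have hD0 : ∀ r ∈ Ioo r_a r_b, HasDerivAt (fun r ↦ ⟪Ψ, u r ξ⟫_ℂ) ⟪Ψ, u₁ r ξ⟫_ℂ r :=
    fun r hr ↦ hasDerivAt_inner_rep Ψ (hd0 r hr)
  have hD1 : ∀ r ∈ Ioo r_a r_b, HasDerivAt (fun r ↦ ⟪Ψ, u₁ r ξ⟫_ℂ) ⟪Ψ, u₂ r ξ⟫_ℂ r :=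
    fun r hr ↦ hasDerivAt_inner_rep Ψ (hd1 r hr)
  have hZ0 : ∀ r ∈ Ioo r_a r_b, r ∉ Icc r_a' r_b' → ⟪Ψ, u r ξ⟫_ℂ = 0 := fun r hr hr' ↦ by
    rw [(hcollar r hr hr').1, inner_zero_right]
  have hZw : ∀ r ∈ Ioo r_a r_b, r ∉ Icc r_a' r_b' → ⟪Ψ, w r ξ⟫_ℂ = 0 := fun r hr hr' ↦ by
    rw [(hcollar r hr hr').2, inner_zero_right]
  -- global derivatives of the zero extensions
  have hc : ∀ r, HasDerivAt cf (cf₁ r) r := hasDerivAt_zeroExtend hra' hrb' hD0 hZ0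
  have hc₁ : ∀ r, HasDerivAt cf₁ (cf₂ r) r := hasDerivAt_zeroExtend_deriv hra' hrb' hD0 hD1 hZ0
  -- the star-chart ODE on `(r₊, ∞)`
  have hodeS : ∀ r ∈ Ioi (rPlus M a), (delta M a r : ℂ) * cf₂ r +
      ((2 * (r - M) : ℝ) + 2 * Complex.I * (a * q.1 - 2 * M * r * ((-2 * π * ξ : ℝ) : ℂ))) * cf₁ r +
      (((-2 * π * ξ) ^ 2 * (r ^ 2 + 2 * M * r) : ℝ) - 2 * Complex.I * M * ((-2 * π * ξ : ℝ) : ℂ) -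
        lam) * cf r = G r := by
    intro r _
    by_cases hr : r ∈ Ioo r_a r_b
    · simp only [hcf, hcf₁, hcf₂, hG, modeCoef, zeroExtend_of_mem hr]
      have h' := hode q r hr
      rw [delta]
      push_cast at h' ⊢
      linear_combination h'
    · simp only [hcf, hcf₁, hcf₂, hG, modeCoef, zeroExtend_of_not_mem hr, mul_zero, add_zero]
  -- the normal form
  set U : ℝ → ℂ := nfU a R ϑ cf with hU
  set U₁ : ℝ → ℂ := nfU₁ M a (-2 * π * ξ) q.1 R ϑ cf cf₁ with hU₁
  set H : ℝ → ℂ := modeH M a R ϑ G with hH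
  set K : ℝ → ℂ := fun x ↦ ((((-2 * π * ξ) ^ 2 -
    sepPotential M a (-2 * π * ξ) q.1 (lam + a ^ 2 * (-2 * π * ξ) ^ 2) (R x) : ℝ)) : ℂ) with hK
  set U₂ : ℝ → ℂ := fun x ↦ H x - K x * U x with hU₂
  have hϑ' : ∀ r ∈ Ioi (rPlus M a),
      HasDerivAt ϑ ((2 * M * r * (-2 * π * ξ) - a * q.1) / delta M a r) r :=
    fun r hr ↦ hasDerivAt_nfPhase hMa (-2 * π * ξ) q.1 hr
  have hUd : ∀ x, HasDerivAt U (U₁ x) x := fun x ↦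
    hasDerivAt_nfU (S := Ioi (rPlus M a)) hR hMa hϑ' (fun r _ ↦ hc r) (hR.rPlus_lt x)
  have hU₁d : ∀ x, HasDerivAt U₁ (U₂ x) x := by
    intro x
    obtain ⟨u₂', hd, heq⟩ := nfU_ode (S := Ioi (rPlus M a)) (lam := lam) (G := G) hR hMa hϑ'
      (fun r _ ↦ hc r) (fun r _ ↦ hc₁ r) hodeS (hR.rPlus_lt x)
    have : u₂' = U₂ x := by
      rw [hU₂]; simp only [hK, hH, modeH, hU]
      linear_combination heq
    rwa [this] at hd
  have hodeU : ∀ x, U₂ x + K x * U x = H x := fun x ↦ by simp only [hU₂]; ring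
  -- support
  have hsupp : ∀ x, x ∉ Icc x_a x_b → U x = 0 ∧ U₁ x = 0 ∧ H x = 0 := by
    intro x hx
    have hRx : R x ∉ Ioo r_a r_b := by
      intro h
      apply hx
      constructor
      · have := (hR.lt_iff_lt hMa).1 (hxa ▸ h.1 : R x_a < R x); exact this.le
      · have := (hR.lt_iff_lt hMa).1 (hxb ▸ h.2 : R x < R x_b); exact this.le
    have h0 : cf (R x) = 0 := zeroExtend_of_not_mem hRx
    have h1 : cf₁ (R x) = 0 := zeroExtend_of_not_mem hRx
    have h2 : G (R x) = 0 := zeroExtend_of_not_mem hRx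
    refine ⟨?_, ?_, ?_⟩
    · simp only [hU, nfU, h0, mul_zero]
    · simp only [hU₁, nfU₁, h0, h1, mul_zero, add_zero, sub_self]
    · simp only [hH, modeH, h2, mul_zero]
  -- continuity
  have hUc : Continuous U := continuous_iff_continuousAt.2 fun x ↦ (hUd x).continuousAt
  have hU₁c : Continuous U₁ := continuous_iff_continuousAt.2 fun x ↦ (hU₁d x).continuousAt
  have hHc : Continuous H := by
    have hGc : Continuous G := by
      refine continuous_zeroExtend hra' hrb' (fun r hr ↦ ?_) hZw
      exact continuousWithinAt_const.inner ((hwc.mono Ioo_subset_Icc_self) r hr)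
    have hϑc : ContinuousOn ϑ (Ioi (rPlus M a)) :=
      fun r hr ↦ (hϑ' r hr).continuousAt.continuousWithinAt
    have hϑR : Continuous fun x ↦ ϑ (R x) :=
      hϑc.comp_continuous hR.continuous fun x ↦ hR.rPlus_lt x
    have hRc := hR.continuous
    have hq : Continuous fun x ↦ ((delta M a (R x) / ((R x ^ 2 + a ^ 2) *
        Real.sqrt (R x ^ 2 + a ^ 2)) : ℝ) : ℂ) := by
      refine Complex.continuous_ofReal.comp ?_
      refine Continuous.div ?_ ?_ fun x ↦ ?_
      · simp only [delta]; fun_prop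
      · fun_prop
      · exact (mul_pos (hR.sq_add_sq_pos hMa x) (Real.sqrt_pos.2 (hR.sq_add_sq_pos hMa x))).ne'
    have hE : Continuous fun x ↦ Complex.exp (-Complex.I * ϑ (R x)) :=
      Complex.continuous_exp.comp (continuous_const.mul (Complex.continuous_ofReal.comp hϑR))
    show Continuous fun x ↦ modeH M a R ϑ G x
    simp only [modeH]
    exact (hq.mul hE).mul (hGc.comp hRc)
  exact ⟨U, U₁, U₂, H, x_a, x_b, rfl, rfl, rfl, hUd, hU₁d, hodeU, hUc, hU₁c, hHc, hsupp,
    isAdmissibleTriple_oblateSphere a (-2 * π * ξ) q⟩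

end Kerr

end Literature.Geometry.Lorentzian
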